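import Summits.ValiantsHypothesis.ValiantsHypothesis.Theorems.LacunarySymmetroidMatrixDescartesCensusTropicalKLaw

/-!
# Route `KPlusLogSqLaw`, crux `TropicalB` — the symmetry principle and the cyclic-equivariant sector

HONEST FRAMING.  Helper file for the crux `Summit.ValiantsHypothesis.ValiantsHypothesis.Theses.KPlusLogSqLaw.TropicalB`
(ledger item `stmt-ValiantsHypothesis-19771`, route `KPlusLogSqLaw`; cell `pub-symmetroid`, seat `val-sym-trop-p2`,
2026-08-26).  The registered stub `stub_tropFat` of `Cruxes/TropicalB/Lines/birth.lean` reads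
`∃ C, ∀ m K, (Nat.log 2 m)^2 ≤ K → TropRow m K (2 ^ (C * K))` (`TropRow ≡ TropicalCensus.TropRootLawAt`, `Iff.rfl`):
"O(1) bits per slope class".  This file does NOT prove it.  It lands, sorry-free and in the tree's dominance vocabulary
(`IsDominant`, `tropWeight`, `termSign` of `…MatrixDescartes.Negative`), three structural facts that every analysis of
the window — upper bound or counterexample — starts from, none of which is a counting statement:

* §1 **No ties at the top / symmetry principle.**  `eq_of_isDominant` : a present term with at least the weight of a
  dominant term IS that term; `isDominant_fixed_of_symmetry` : if a pair of relabellings `(α, β)` of rows and columns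
  preserves the valuations and the presence/sign pattern of a design (`v (α a) (β b) l = v a b l`, same for `ε`), then every
  dominant term `(σ, λ)` is FIXED by the induced map on Leibniz terms: `α * σ * β⁻¹ = σ` and `λ ∘ β⁻¹ = λ`.  A unique
  optimum is invariant under every symmetry of the problem — the one-line reason why a search for many-breakpoint designs
  inside a SYMMETRIC design space is self-defeating: the dominant terms of a `G`-equivariant design are `G`-fixed.
* §2 **The cyclic-equivariant ("circulant") sector, all `(m, K)`, in-window, absolute constant.**  If valuations and
  signs depend only on the cyclic shift `a - b ∈ Fin m` of the entry and on the class (`v a b l = f (a - b) l`,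
  `ε a b l = g (a - b) l`), then every dominant term is a ROTATION with a CONSTANT class map
  (`dominant_circulant_eq_rotation`), and a sign-alternating dominant chain has at most `K` terms
  (`chain_succ_le_of_circulant`, `0 < m`; all-format form `chain_le_pred_of_circulant : n ≤ K - 1`).  Counting gives
  `C(m+K-1, m) - 1` on this sector like on any other; the sector bound is `K - 1` for every `m`.  Located consequence for
  the cell's kill list (ONBOARD §3.2, D3): an annealer "restricted to circulant-invariant designs" cannot find a third
  digit — it cannot even find a second; the only additive two-digit mechanism on record (SHIFT-THREE,
  `…TropicalShiftThree`) lives on a circulant BACKBONE `pen(shift)` plus a symmetry-BREAKING column price `2(b+1)`.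
* §3 **The permutation fibre of a chain.**  In ANY design, the chain terms carrying one fixed permutation `σ` number at
  most `m·(K-1) + 1` (`card_filter_fst_eq_le` — the entrywise optimal class is monotone in `θ`, tree lemma
  `TropicalCensus.d_lt_of_dominant`), hence `n + 1 ≤ (m(K-1)+1) · #{permutations occurring in the chain}`
  (`chain_succ_le_mul_card_perms`).  This is the per-`σ` FIBRE form of the thin law `tropRootLawAt_thin` (which takes all
  `m!` permutations): super-polynomial alternation counts are exactly large families of pairwise distinct DOMINANT
  PERMUTATIONS ("permutation registers"); class flips contribute one factor `m(K-1)+1`.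

Nothing in this file asserts `TropicalB`, `KPlusLogSqLaw`, `MatrixDescartes` or anything about `VP ≠ VNP`.

References: the dominance vocabulary and `le_card_posRoots_patch` (Viro patchworking) are the tree's
`…MatrixDescartes.Negative.MatrixDescartesFalseOfTropicalMonster`; the thin law and `d_lt_of_dominant` are
`…CensusTropicalKLaw`; injectivity of dominant chains is `stub_dominantInjective`.  The symmetry principle is folklore
(uniqueness of an optimum ⇒ invariance under the automorphism group of the instance).
-/

set_option linter.dupNamespace false
set_option autoImplicit false

namespace Summit.ValiantsHypothesis.ValiantsHypothesis.Theorems.KPlusLogSqLaw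

open Summit.ValiantsHypothesis.ValiantsHypothesis.Theorems.MatrixDescartes.Negative
open Summit.ValiantsHypothesis.ValiantsHypothesis.Theorems.LacunarySymmetroidMatrixDescartes
open Summit.ValiantsHypothesis.ValiantsHypothesis.Theorems.LacunarySymmetroidMatrixDescartes.TropicalCensus
open scoped BigOperators
open Finset

/-! ## 1. No ties at the top; dominant terms are fixed by every symmetry of the design -/

section Symmetry

variable {m K : ℕ}

/-- **No ties at the top.**  If `p` is the unique optimum at slope `θ` and `q` is a present term whose tropical weight
at `θ` is at least that of `p`, then `q = p`. [folklore] -/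
theorem eq_of_isDominant (d : Fin K → ℕ) (v ε : Fin m → Fin m → Fin K → ℤ) (θ : ℤ)
    {p q : Equiv.Perm (Fin m) × (Fin m → Fin K)} (hp : IsDominant d v ε θ p) (hq : termSign ε q ≠ 0)
    (hw : tropWeight d v θ p ≤ tropWeight d v θ q) : q = p := by
  by_contra hne
  exact absurd hw (not_le.mpr (hp.2 q hne hq))

/-- The relabelled term has the same tropical weight when the relabelling preserves the valuations. [folklore] -/
theorem tropWeight_relabelTerm (d : Fin K → ℕ) (v : Fin m → Fin m → Fin K → ℤ) (α β : Equiv.Perm (Fin m))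
    (hv : ∀ a b l, v (α a) (β b) l = v a b l) (θ : ℤ) (p : Equiv.Perm (Fin m) × (Fin m → Fin K)) :
    tropWeight d v θ (α * p.1 * β⁻¹, fun j => p.2 (β.symm j)) = tropWeight d v θ p := by
  unfold tropWeight
  dsimp only
  have h1 : ∑ j, (d (p.2 (β.symm j)) : ℤ) = ∑ i, (d (p.2 i) : ℤ) :=
    Equiv.sum_comp β.symm (fun i => (d (p.2 i) : ℤ))
  have h2 : ∑ j, v ((α * p.1 * β⁻¹) j) j (p.2 (β.symm j)) = ∑ i, v (p.1 i) i (p.2 i) := by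
    rw [← Equiv.sum_comp β (fun j => v ((α * p.1 * β⁻¹) j) j (p.2 (β.symm j)))]
    refine sum_congr rfl fun i _ => ?_
    simp only [Equiv.Perm.mul_apply, Equiv.Perm.inv_def, Equiv.symm_apply_apply]
    exact hv _ _ _
  rw [h1, h2]

/-- The relabelled term is present iff the original term is, when the relabelling preserves the sign pattern. [folklore] -/
theorem termSign_relabelTerm_ne_zero (ε : Fin m → Fin m → Fin K → ℤ) (α β : Equiv.Perm (Fin m))
    (hε : ∀ a b l, ε (α a) (β b) l = ε a b l) (p : Equiv.Perm (Fin m) × (Fin m → Fin K))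
    (hp : termSign ε p ≠ 0) : termSign ε (α * p.1 * β⁻¹, fun j => p.2 (β.symm j)) ≠ 0 := by
  unfold termSign at *
  dsimp only
  have h2 : ∏ j, ε ((α * p.1 * β⁻¹) j) j (p.2 (β.symm j)) = ∏ i, ε (p.1 i) i (p.2 i) := by
    rw [← Equiv.prod_comp β (fun j => ε ((α * p.1 * β⁻¹) j) j (p.2 (β.symm j)))]
    refine prod_congr rfl fun i _ => ?_
    simp only [Equiv.Perm.mul_apply, Equiv.Perm.inv_def, Equiv.symm_apply_apply]
    exact hε _ _ _
  rw [h2]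
  exact mul_ne_zero (Units.ne_zero _) (mul_ne_zero_iff.mp hp).2

/-- **Symmetry principle.**  If the relabelling `(α, β)` of rows and columns preserves the valuations and the sign pattern
of a design, then every dominant term is FIXED by the induced map on Leibniz terms: a unique optimum is invariant under
every automorphism of the instance.  In particular the dominant terms of a `G`-equivariant design are `G`-fixed, for any
group `G` of such relabellings. [folklore] -/
theorem isDominant_fixed_of_symmetry (d : Fin K → ℕ) (v ε : Fin m → Fin m → Fin K → ℤ) (α β : Equiv.Perm (Fin m))
    (hv : ∀ a b l, v (α a) (β b) l = v a b l) (hε : ∀ a b l, ε (α a) (β b) l = ε a b l) (θ : ℤ)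
    (p : Equiv.Perm (Fin m) × (Fin m → Fin K)) (hp : IsDominant d v ε θ p) :
    (α * p.1 * β⁻¹, fun j => p.2 (β.symm j)) = p :=
  eq_of_isDominant d v ε θ hp (termSign_relabelTerm_ne_zero ε α β hε p hp.1)
    (le_of_eq (tropWeight_relabelTerm d v α β hv θ p).symm)

/-- Unfolded form of the symmetry principle: `α σ β⁻¹ = σ` and `λ ∘ β⁻¹ = λ`. [folklore] -/
theorem isDominant_fixed_of_symmetry' (d : Fin K → ℕ) (v ε : Fin m → Fin m → Fin K → ℤ) (α β : Equiv.Perm (Fin m))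
    (hv : ∀ a b l, v (α a) (β b) l = v a b l) (hε : ∀ a b l, ε (α a) (β b) l = ε a b l) (θ : ℤ)
    (σ : Equiv.Perm (Fin m)) (μ : Fin m → Fin K) (hp : IsDominant d v ε θ (σ, μ)) :
    α * σ * β⁻¹ = σ ∧ (fun j => μ (β.symm j)) = μ :=
  Prod.mk.inj (isDominant_fixed_of_symmetry d v ε α β hv hε θ (σ, μ) hp)

end Symmetry

/-! ## 2. The cyclic-equivariant (circulant) sector: dominant terms are rotations with a constant class -/

section Circulant

variable {n K : ℕ}

/-- the weight of the rotation term of a circulant design: `(n+1)·(θ·d l − f s l)` [folklore] -/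
theorem tropWeight_rotationTerm (d : Fin K → ℕ) (f : Fin (n + 1) → Fin K → ℤ) (θ : ℤ) (s : Fin (n + 1)) (l : Fin K) :
    tropWeight d (fun a b l => f (a - b) l) θ (Equiv.addRight s, fun _ => l) = (n + 1 : ℕ) * (θ * d l - f s l) := by
  unfold tropWeight
  dsimp only
  simp only [Equiv.coe_addRight, add_sub_cancel_left, sum_const, card_univ, Fintype.card_fin]
  push_cast
  ring

/-- the sign of the rotation term of a circulant design: `sign (j ↦ j + s) · (g s l)^(n+1)` [folklore] -/
theorem termSign_rotationTerm (g : Fin (n + 1) → Fin K → ℤ) (s : Fin (n + 1)) (l : Fin K) :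
    termSign (fun a b l => g (a - b) l) (Equiv.addRight s, fun _ => l) =
      (Equiv.Perm.sign (Equiv.addRight s) : ℤ) * g s l ^ (n + 1) := by
  unfold termSign
  dsimp only
  simp only [Equiv.coe_addRight, add_sub_cancel_left, prod_const, card_univ, Fintype.card_fin]

/-- the tropical weight of any term is the sum over the columns of `θ·d(class) − valuation` [folklore] -/
theorem tropWeight_eq_sum {m : ℕ} (d : Fin K → ℕ) (v : Fin m → Fin m → Fin K → ℤ) (θ : ℤ)
    (p : Equiv.Perm (Fin m) × (Fin m → Fin K)) :
    tropWeight d v θ p = ∑ i, (θ * d (p.2 i) - v (p.1 i) i (p.2 i)) := by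
  unfold tropWeight
  rw [sum_sub_distrib, mul_sum]

/-- **Structure theorem of the circulant sector.**  In a design whose valuations and signs depend only on the cyclic
shift `a - b` of the entry and the class, every dominant term is a rotation `j ↦ j + s` with a constant class map.
Proof: the summand of the weight at column `i` is `θ·d(λ i) − f (σ i − i) (λ i)`; the rotation term built from a column
with the LARGEST summand is present and weighs `(n+1)·max ≥ Σ`, so by uniqueness of the optimum it is the dominant term.
[folklore] -/
theorem dominant_circulant_eq_rotation (d : Fin K → ℕ) (f g : Fin (n + 1) → Fin K → ℤ) (θ : ℤ)
    (p : Equiv.Perm (Fin (n + 1)) × (Fin (n + 1) → Fin K))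
    (hp : IsDominant d (fun a b l => f (a - b) l) (fun a b l => g (a - b) l) θ p) :
    ∃ i : Fin (n + 1), p = (Equiv.addRight (p.1 i - i), fun _ => p.2 i) := by
  -- the column summands of the weight of `p`
  set w : Fin (n + 1) → ℤ := fun i => θ * d (p.2 i) - f (p.1 i - i) (p.2 i) with hw
  obtain ⟨i₀, -, hi₀⟩ := exists_max_image univ w (univ_nonempty (α := Fin (n + 1)))
  refine ⟨i₀, (eq_of_isDominant d _ _ θ hp ?_ ?_).symm⟩
  · -- the rotation term is present: its sign is `± (g s l)^(n+1)` and `g s l ≠ 0` is a factor of `termSign p ≠ 0`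
    rw [termSign_rotationTerm]
    refine mul_ne_zero (Units.ne_zero _) (pow_ne_zero _ ?_)
    have h := (mul_ne_zero_iff.mp hp.1).2
    rw [prod_ne_zero_iff] at h
    exact h i₀ (mem_univ _)
  · -- its weight `(n+1)·w i₀` dominates `Σ w`
    rw [tropWeight_rotationTerm, tropWeight_eq_sum]
    calc ∑ i, (θ * d (p.2 i) - f (p.1 i - i) (p.2 i)) = ∑ i, w i := rfl
      _ ≤ ∑ _i : Fin (n + 1), w i₀ := sum_le_sum fun i _ => hi₀ i (mem_univ _)
      _ = (n + 1 : ℕ) * (θ * d (p.2 i₀) - f (p.1 i₀ - i₀) (p.2 i₀)) := by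
          rw [sum_const, card_univ, Fintype.card_fin, nsmul_eq_mul]

/-- **The circulant sector has at most `K` chain terms** (`0 < m`, here `m = n + 1`): two dominant rotation terms with
the SAME class have a slope-independent weight difference, so each class occurs at most once along a dominant chain at
strictly increasing slopes; hence `n' + 1 ≤ K` for a sign-alternating dominant chain of `n' + 1` terms.  Non-counting,
valid for every format, absolute constant: on this sector `TropicalB` holds with room to spare, while slope counting
only gives `C(m+K-1, m) - 1`. [folklore] -/
theorem chain_succ_le_of_circulant (d : Fin K → ℕ) (f g : Fin (n + 1) → Fin K → ℤ) (N : ℕ)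
    (θ : Fin (N + 1) → ℤ) (p : Fin (N + 1) → Equiv.Perm (Fin (n + 1)) × (Fin (n + 1) → Fin K))
    (hθ : StrictMono θ) (hdom : ∀ k, IsDominant d (fun a b l => f (a - b) l) (fun a b l => g (a - b) l) (θ k) (p k))
    (halt : ∀ k : Fin N, termSign (fun a b l => g (a - b) l) (p k.castSucc) *
      termSign (fun a b l => g (a - b) l) (p k.succ) < 0) : N + 1 ≤ K := by
  have hinj : Function.Injective p := stub_dominantInjective (n + 1) K d _ _ N θ p hθ hdom halt
  -- every chain term is a rotation term
  choose i hi using fun k => dominant_circulant_eq_rotation d f g (θ k) (p k) (hdom k)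
  -- the class of the chain term `k`
  let cls : Fin (N + 1) → Fin K := fun k => (p k).2 (i k)
  suffices hcls : Function.Injective cls by
    simpa using Fintype.card_le_of_injective cls hcls
  intro a b hab
  by_contra hne
  -- the two rotation terms share the class `l`; their weight difference does not depend on `θ`
  set l := cls a with hl
  have hpa : p a = (Equiv.addRight ((p a).1 (i a) - i a), fun _ => l) := hi a
  have hpb : p b = (Equiv.addRight ((p b).1 (i b) - i b), fun _ => l) := by
    rw [show l = (p b).2 (i b) from hab]; exact hi b
  have hne' : p a ≠ p b := fun h => hne (hinj h)
  have h1 := (hdom a).2 (p b) (Ne.symm hne') (hdom b).1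
  have h2 := (hdom b).2 (p a) hne' (hdom a).1
  rw [hpa, hpb, tropWeight_rotationTerm, tropWeight_rotationTerm] at h1 h2
  have hpos : (0 : ℤ) < (n + 1 : ℕ) := by exact_mod_cast Nat.succ_pos n
  nlinarith

end Circulant

/-- **Circulant sector, all formats.**  For every `m, K`: a sign-alternating dominant chain of a cyclic-equivariant design
of format `(m, K)` has at most `K - 1` breakpoints (`m = 0`: the unique empty term, no breakpoint). [folklore] -/
theorem chain_le_pred_of_circulant {m K : ℕ} (d : Fin K → ℕ) (f g : Fin m → Fin K → ℤ) (N : ℕ)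
    (θ : Fin (N + 1) → ℤ) (p : Fin (N + 1) → Equiv.Perm (Fin m) × (Fin m → Fin K))
    (hθ : StrictMono θ) (hdom : ∀ k, IsDominant d (fun a b l => f (a - b) l) (fun a b l => g (a - b) l) (θ k) (p k))
    (halt : ∀ k : Fin N, termSign (fun a b l => g (a - b) l) (p k.castSucc) *
      termSign (fun a b l => g (a - b) l) (p k.succ) < 0) : N ≤ K - 1 := by
  rcases Nat.eq_zero_or_pos m with hm | hm
  · -- `m = 0`: all terms coincide, so there is no alternation
    subst hm
    rcases Nat.eq_zero_or_pos N with hN | hN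
    · omega
    · exfalso
      have h := halt ⟨0, hN⟩
      have heq : p (⟨0, hN⟩ : Fin N).castSucc = p (⟨0, hN⟩ : Fin N).succ := Subsingleton.elim _ _
      rw [heq] at h
      exact absurd h (not_lt.mpr (mul_self_nonneg _))
  · obtain ⟨n, rfl⟩ := Nat.exists_eq_succ_of_ne_zero hm.ne'
    have := chain_succ_le_of_circulant d f g N θ p hθ hdom halt
    omega

/-! ## 3. The permutation fibre of a dominant chain -/

section Fibre

variable {m K : ℕ}

/-- **Permutation fibre.**  Along a sign-alternating dominant chain at strictly increasing slopes, the terms carrying a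
fixed permutation `σ` number at most `m·(K-1) + 1`: their class vectors strictly increase in the product order of
exponents (`TropicalCensus.d_lt_of_dominant`), so their total exponent rank `termRank ∈ [0, m(K-1)]` is injective on the
fibre. [folklore] -/
theorem card_filter_fst_eq_le (d : Fin K → ℕ) (v ε : Fin m → Fin m → Fin K → ℤ) (N : ℕ) (θ : Fin (N + 1) → ℤ)
    (p : Fin (N + 1) → Equiv.Perm (Fin m) × (Fin m → Fin K)) (hθ : StrictMono θ)
    (hdom : ∀ k, IsDominant d v ε (θ k) (p k))
    (halt : ∀ k : Fin N, termSign ε (p k.castSucc) * termSign ε (p k.succ) < 0) (σ : Equiv.Perm (Fin m)) :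
    (univ.filter fun k => (p k).1 = σ).card ≤ m * (K - 1) + 1 := by
  have hinj : Function.Injective p := stub_dominantInjective m K d v ε N θ p hθ hdom halt
  -- same permutation and `a < b` forces `termRank (p a) < termRank (p b)` (as in `tropRootLawAt_thin`)
  have hkey : ∀ a b : Fin (N + 1), a < b → (p a).1 = (p b).1 → termRank d (p a) < termRank d (p b) := by
    intro a b hab h1
    have hne : p a ≠ p b := fun h => (ne_of_lt hab) (hinj h)
    have h2 : (p a).2 ≠ (p b).2 := fun h => hne (Prod.ext h1 h)
    obtain ⟨i, hi⟩ := Function.ne_iff.mp h2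
    have hpa : p a = ((p a).1, (p a).2) := rfl
    have hpb : p b = ((p a).1, (p b).2) := by rw [h1]
    have hda : IsDominant d v ε (θ a) ((p a).1, (p a).2) := hpa ▸ hdom a
    have hdb : IsDominant d v ε (θ b) ((p a).1, (p b).2) := hpb ▸ hdom b
    have hmono : ∀ j, dRank d ((p a).2 j) ≤ dRank d ((p b).2 j) := by
      intro j
      by_cases hj : (p a).2 j = (p b).2 j
      · rw [hj]
      · exact (dRank_lt_of_lt d (d_lt_of_dominant d v ε (hθ hab) _ _ _ hda hdb j hj)).le
    have hstrict : dRank d ((p a).2 i) < dRank d ((p b).2 i) :=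
      dRank_lt_of_lt d (d_lt_of_dominant d v ε (hθ hab) _ _ _ hda hdb i hi)
    unfold termRank
    exact sum_lt_sum (fun j _ => hmono j) ⟨i, mem_univ _, hstrict⟩
  -- `termRank` is injective on the fibre, with values in `Fin (m(K-1)+1)`
  let S := univ.filter fun k => (p k).1 = σ
  let f : S → Fin (m * (K - 1) + 1) := fun k => ⟨termRank d (p k), Nat.lt_succ_of_le (termRank_le d (p k))⟩
  have hf : Function.Injective f := by
    rintro ⟨a, ha⟩ ⟨b, hb⟩ hfab
    have ha' : (p a).1 = σ := (mem_filter.mp ha).2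
    have hb' : (p b).1 = σ := (mem_filter.mp hb).2
    have h2 : termRank d (p a) = termRank d (p b) := by
      have := congrArg (fun q : Fin (m * (K - 1) + 1) => (q : ℕ)) hfab
      simpa [f] using this
    rcases lt_trichotomy a b with h | h | h
    · exact absurd h2 (ne_of_lt (hkey a b h (ha'.trans hb'.symm)))
    · exact Subtype.ext h
    · exact absurd h2.symm (ne_of_lt (hkey b a h (hb'.trans ha'.symm)))
  have hcard := Fintype.card_le_of_injective f hf
  rwa [Fintype.card_coe, Fintype.card_fin] at hcard

/-- **Chains factor through their permutations.**  A sign-alternating dominant chain of `N + 1` terms whose permutations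
all lie in a finite set `F` satisfies `N + 1 ≤ (m(K-1)+1) · |F|`: class flips buy one factor `m(K-1)+1`, everything else is
the number of distinct DOMINANT PERMUTATIONS.  (`F = univ` is the thin law `tropRootLawAt_thin`.) [folklore] -/
theorem chain_succ_le_mul_card_perms (d : Fin K → ℕ) (v ε : Fin m → Fin m → Fin K → ℤ) (N : ℕ)
    (θ : Fin (N + 1) → ℤ) (p : Fin (N + 1) → Equiv.Perm (Fin m) × (Fin m → Fin K)) (hθ : StrictMono θ)
    (hdom : ∀ k, IsDominant d v ε (θ k) (p k))
    (halt : ∀ k : Fin N, termSign ε (p k.castSucc) * termSign ε (p k.succ) < 0)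
    (F : Finset (Equiv.Perm (Fin m))) (hF : ∀ k, (p k).1 ∈ F) :
    N + 1 ≤ (m * (K - 1) + 1) * F.card := by
  -- partition the chain indices by their permutation
  have hcard : (univ : Finset (Fin (N + 1))).card = ∑ σ ∈ F, (univ.filter fun k => (p k).1 = σ).card :=
    card_eq_sum_card_fiberwise fun k _ => hF k
  rw [card_univ, Fintype.card_fin] at hcard
  calc N + 1 ≤ ∑ σ ∈ F, (univ.filter fun k => (p k).1 = σ).card := hcard.le
    _ ≤ ∑ _σ ∈ F, (m * (K - 1) + 1) := sum_le_sum fun σ _ => card_filter_fst_eq_le d v ε N θ p hθ hdom halt σ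
    _ = (m * (K - 1) + 1) * F.card := by rw [sum_const, smul_eq_mul, mul_comm]

end Fibre

end Summit.ValiantsHypothesis.ValiantsHypothesis.Theorems.KPlusLogSqLaw
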